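/-
Copyright (c) 2026 the pub-hodgecm-mathlib formalisation cell (harness21).  Prover seat hodgecm-mathlib-K2E4-p11 (g3), Track B ∕ K2-LIT, h413 =
`stmt-HodgeConjecture-24833`, line `K2_E1_TraceFormulaBeta`, campaign «EIS-RANK-ONE», rung R6d₃, deal (D2-c) PART I of K2E1-plan (g3) 2026-09-04T05:52:56Z, FILE B:
the `E`-layer (centre average) `Φ^Z_g(X) = μ_F(D_F)⁻¹ ∫_{𝔸_F} Φ_g(X, t) dt` of the big-cell function on the Heisenberg group of `U(J₃)` — level periodicity, `hlocZ`, `hΦZc`, `hΦZi`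
of ★ p857586, from the Eisenstein majorant alone.
-/
import Summits.HodgeConjecture.HodgeConjecture.Theorems.K2E1FlatSectionLineRestrictionU3   -- ★ p857785 FILE A: line algebra, master majorant, `hloc`, `hΦi`, §0 lattice lemma
import Literature.NumberTheory.Automorphic.UnitaryGroupTraceZeroLineHaar                   -- ★ `integral_map_traceZeroLine`, `isAddHaarMeasure_map_traceZeroLine`
import Literature.NumberTheory.Automorphic.UnitaryGroupHeisenbergXLineLatticeUnfolding      -- ★ `integrable_tsum_of_tsum_lintegral_enorm_ne_top` (Rudin 1.38)
import HarnessLib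

/-!
# h413 ∕ Track B «K2-LIT», «EIS-RANK-ONE» R6d₃ (D2-c) PART I, FILE B — `K2E1FlatSectionCentreAverageU3`:
# the centre average `Φ^Z_g(X) = μ_F(D_F)⁻¹ · ∫_{𝔸_F} f(ι(w₀)·u(X, θ t)·g) dt` on `N∕Z ≅ 𝔸_E`: `E`-level periodicity, the Poisson binders `hlocZ`, `hΦZc`, `hΦZi` of
# ★ p857586 — from the Eisenstein majorant alone

Cell `pub/hodgecm-mathlib`, crux H413 = `stmt-HodgeConjecture-24833`, route `HCCMUnconditional`; dealer K2E1-plan (g3), deal (D2-c) 2026-09-04T05:52:56Z; REPORT-FIRST 05:56:16Z; FILE A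
= ★ p857785 `K2E1FlatSectionLineRestrictionU3`.  THEOREMS ONLY (no `def`, no `instance`, no `notation`, no named-fact hypothesis, no `sorry`); lane `--kind proof --supports
stmt-HodgeConjecture-24833 --as helper` (count-neutral).  Letters of ★ p857586 verbatim: `Φ_g(X,t) = f(ι(w₀)·u(X, θ t)·g)`, `Φ^Z_g(X) = ((μ_F D_F).toReal⁻¹ : ℂ) · ∫ Φ_g(X,t) dμ_F(t)`.
* §0 `lintegral_enorm_le_of_lattice_majorant` — the quantitative form of ★ FILE A §0: `∫⁻ ‖Ψ‖ ≤ (Σ u) · μ(D_K)` for a lattice-translate majorant on `D_K` (no measurability needed).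
* §1 `heisChart_fst_zero_mul` — `u(L, 0) · u(X, s) = u(L + X, s + ω)`, the cross term `ω = y(u(L,0)·u(X,0)) ∈ 𝔸_E⁻` packaged as a coordinate (companion of ★ `heisChart_add_eq_mul`).
* §2 (ii, `E`-layer) **`integral_weylLongU_mul_heisChart_add_eq`** — for right-`U`-invariant `f` and `k⁻¹ · u(L, 0) · k ∈ U`: `∫ Φ_k(X + L, t) dt = ∫ Φ_k(X, t) dt` (★ `integral_heisChart_add_eq`
  transported along `θ`, ★ `integral_map_traceZeroLine`): with FILE A's tube lemma, ONE level `𝔪` for all `k ∈ K`.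
* §3 **`hlocZ`** `exists_summable_majorant_centreAverage_translate_three` — for compact `C_X ⊆ 𝔸_E` ONE summable `u : E → ℝ` with `‖Φ^Z_g(X + ξ₀)‖ ≤ u(ξ₀)` (`X ∈ C_X`, `ξ₀ ∈ E`):
  `u(X + ξ₀, θ t) = u(ξ₀, 0) · u(X, θ t − ω)` (§1), the `ω`-shift dies in `dt`, then the `F`-lattice decomposition of `∫⁻ ‖·‖` over `D_F` (§0) turns `u(ξ₀, 0) · u(0, θ τ) = u(ξ₀, θ τ)`
  into FILE A's master majorant at the cosets `[w₀ u(ξ₀, τδ)]`: `u(ξ₀) = ‖μ_F(D_F)⁻¹‖ · μ_F(D_F) · Σ_τ U(ξ₀, τ)`, summable over `ξ₀` (Mathlib `summable_prod_of_nonneg`).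
* §4 **`hΦZc`** `continuous_centreAverage_three` — dominated convergence on compact neighbourhoods (Mathlib `continuousOn_of_dominated`) with the LATTICE-PIECEWISE-CONSTANT bound
  `t ↦ Σ_τ 𝟙_{τ + D_F}(t)·u(τ)` from FILE A's `hloc` (integrable by ★ `integrable_tsum_of_tsum_lintegral_enorm_ne_top`).
* §5 **`hΦZi`** `integrable_centreAverage_three` — ★ FILE A §0 over `E` with §3's majorant on `D_E⁻` and §4's continuity.
Also `exists_summable_majorant_centre_translate_three'` — FILE A's `hloc` in ★ p857586's spelling `x + ξ_𝔸` of the translate.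
HONEST LABEL.  Count-neutral helper; proves no printed statement; HC_CM is proved only modulo the 7 printed citations (2 remaining named inputs: hLiu418 =
`stmt-HodgeConjecture-24832`, h413 = `stmt-HodgeConjecture-24833`) until rung 0 closes.

## References
* [MoeglinWaldspurger1995] C. Mœglin, J.-L. Waldspurger, *Spectral decomposition and Eisenstein series* (1995), I.2.6, II.1.5, II.1.7.
* [Garrett2018] P. Garrett, *Modern Analysis of Automorphic Forms by Example* 1 (2018), §2.8–§2.9.
* [Rogawski1990] J. D. Rogawski, *Automorphic Representations of Unitary Groups in Three Variables* (1990), §1.10, §2.1, §7.3.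
* [CasselsFrohlichANT1967] J. W. S. Cassels, A. Fröhlich (eds.), *Algebraic Number Theory* (1967), Ch. XV (Tate) Lemma 4.2.4.
* [Rudin1987] W. Rudin, *Real and Complex Analysis*, 3rd ed. (1987), Thm. 1.38.
-/

set_option autoImplicit false
set_option linter.dupNamespace false  -- the mandated namespace repeats the summit's segment (`HodgeConjecture.HodgeConjecture`)

noncomputable section

open MeasureTheory Measure Filter Topology NumberField IsDedekindDomain MulAction Set
open Literature.NumberTheory.Automorphic Literature.NumberTheory.Automorphic.UnitaryGroup
open Summit.HodgeConjecture.HodgeConjecture.Cruxes.H413.K2E1BorelEisensteinU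
open Summit.HodgeConjecture.HodgeConjecture.Cruxes.H413.K2E1FlatSectionLineRestrictionU3
open scoped ENNReal NNReal Pointwise

namespace Summit.HodgeConjecture.HodgeConjecture.Cruxes.H413.K2E1FlatSectionCentreAverageU3

/-! ## §0 The quantitative lattice bound -/

section Lattice

/-- **`∫⁻ ‖Ψ‖ ≤ (Σ u) · μ(D_K)`** for a lattice-translate majorant `‖Ψ(ξ + x)‖ ≤ u(ξ)` (`x ∈ D_K`, `ξ ∈ K`, `u ≥ 0` summable); any number field, any additive Haar `μ`, no measurability
needed (★ `isAddFundamentalDomain_adeleFundamentalDomain`). [cite: CasselsFrohlichANT1967, Ch. XV Lemma 4.2.4] -/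
theorem lintegral_enorm_le_of_lattice_majorant (K : Type) [Field K] [NumberField K] [MeasurableSpace (AdeleRing (𝓞 K) K)] [BorelSpace (AdeleRing (𝓞 K) K)]
    (μ : Measure (AdeleRing (𝓞 K) K)) [μ.IsAddHaarMeasure] {V : Type*} [NormedAddCommGroup V] (Ψ : AdeleRing (𝓞 K) K → V)
    {u : K → ℝ} (hu0 : ∀ ξ, 0 ≤ u ξ) (hu : Summable u)
    (hle : ∀ x ∈ adeleFundamentalDomain K, ∀ ξ : K, ‖Ψ (algebraMap K (AdeleRing (𝓞 K) K) ξ + x)‖ ≤ u ξ) :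
    ∫⁻ x, ‖Ψ x‖ₑ ∂μ ≤ ENNReal.ofReal (∑' ξ : K, u ξ) * μ (adeleFundamentalDomain K) := by
  classical
  have h𝓓 := isAddFundamentalDomain_adeleFundamentalDomain K μ
  rw [h𝓓.lintegral_eq_tsum'' fun x => ‖Ψ x‖ₑ, ← (principalSubgroupEquiv K).tsum_eq, ENNReal.ofReal_tsum_of_nonneg hu0 hu, ← ENNReal.tsum_mul_right]
  refine ENNReal.tsum_le_tsum fun ξ => ?_
  calc ∫⁻ x in adeleFundamentalDomain K, ‖Ψ ((principalSubgroupEquiv K ξ) +ᵥ x)‖ₑ ∂μ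
      ≤ ∫⁻ _ in adeleFundamentalDomain K, ENNReal.ofReal (u ξ) ∂μ := by
        refine setLIntegral_mono measurable_const fun x hx => ?_
        rw [← ofReal_norm]
        exact ENNReal.ofReal_le_ofReal (hle x hx ξ)
    _ = ENNReal.ofReal (u ξ) * μ (adeleFundamentalDomain K) := setLIntegral_const _ _

end Lattice

section Heisenberg

variable {F E : Type} [Field F] [NumberField F] [Field E] [NumberField E] [Algebra F E] [Algebra.IsQuadraticExtension F E] {c : E ≃ₐ[F] E}
  {δ : E}

/-! ## §1 The `X`-translation law with the rational factor on the left -/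

omit [Algebra.IsQuadraticExtension F E] in
/-- **`u(L, 0) · u(X, s) = u(L + X, s + ω)`** with the Heisenberg cross term `ω = y(u(L,0)·u(X,0)) ∈ 𝔸_E⁻` (coordinates ★ `coordX_mul_heisChart`, ★ `coe_coordY_mul_heisChart`).
[cite: Rogawski1990, §1.10] -/
theorem heisChart_fst_zero_mul (hc : c * c = 1) (L X : AdeleRing (𝓞 E) E) (s : traceZeroAdele F E c) :
    heisChart hc (L, 0) * heisChart hc (X, s) = heisChart hc (L + X, s + coordY hc (heisChart hc (L, 0) * heisChart hc (X, 0))) := by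
  rw [← heisChart_coord hc (heisChart hc (L, 0) * heisChart hc (X, s))]
  congr 1
  refine Prod.ext ?_ (Subtype.ext ?_)
  · rw [coordX_mul_heisChart, coordX_heisChart]
  · rw [coe_coordY_mul_heisChart, coordY_heisChart, coordX_heisChart, AddMemClass.coe_add, coe_coordY_mul_heisChart, coordY_heisChart, coordX_heisChart]
    simp only [ZeroMemClass.coe_zero, zero_add]

/-! ## §2 (ii) `E`-level periodicity of the centre average -/

section Periodicity

variable [MeasurableSpace (AdeleRing (𝓞 F) F)] [BorelSpace (AdeleRing (𝓞 F) F)] [MeasurableSpace (AdeleRing (𝓞 E) E)] [BorelSpace (AdeleRing (𝓞 E) E)]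

/-- **`E`-LEVEL PERIODICITY OF THE CENTRE AVERAGE**: for a right-`U`-invariant `f` (`U` a subgroup) and `k` with `k⁻¹ · u(L, 0) · k ∈ U`, every additive Haar `μ` on `𝔸_F` and every `X`:
`∫ f(ι(w₀)·u(X + L, θ t)·k) dμ(t) = ∫ f(ι(w₀)·u(X, θ t)·k) dμ(t)` — ★ `integral_heisChart_add_eq` (`u(X+L, w) = u(X, w − ω)·u(L, 0)`, the shift dies in `dw`) transported along `θ`
(★ `integral_map_traceZeroLine`).  With FILE A's tube lemma: ONE level `𝔪` for all `k ∈ K`. [cite: Rogawski1990, §7.3 (pp. 96–97)] [cite: WeilBNT1967, Ch. VII §2] -/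
theorem integral_weylLongU_mul_heisChart_add_eq (hc : c * c = 1) (hcδ : c δ = -δ) (hδ : δ ≠ 0) (μ : Measure (AdeleRing (𝓞 F) F)) [μ.IsAddHaarMeasure]
    {V : Type*} [NormedAddCommGroup V] [NormedSpace ℝ V] {f : (quasiSplit F E c 3).Adelic → V} {U : Subgroup (quasiSplit F E c 3).Adelic}
    (hfU : ∀ v ∈ U, ∀ y : (quasiSplit F E c 3).Adelic, f (y * v) = f y) {k : (quasiSplit F E c 3).Adelic} {L : AdeleRing (𝓞 E) E}
    (hk : k⁻¹ * ((heisChart hc (L, (0 : traceZeroAdele F E c)) : ↥(adelicUnipotent F E c 3)) : (quasiSplit F E c 3).Adelic) * k ∈ U) (X : AdeleRing (𝓞 E) E) :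
    ∫ t, f (((quasiSplit F E c 3).toAdelic (weylLongU (c : E →+* E) (rfl : ((StdForm.antidiagonal 3).over E) = ((StdForm.antidiagonal 3).over E)))) *
        ((heisChart hc (X + L, traceZeroLine F E c hcδ hδ t) : ↥(adelicUnipotent F E c 3)) : (quasiSplit F E c 3).Adelic) * k) ∂μ =
      ∫ t, f (((quasiSplit F E c 3).toAdelic (weylLongU (c : E →+* E) (rfl : ((StdForm.antidiagonal 3).over E) = ((StdForm.antidiagonal 3).over E)))) *
        ((heisChart hc (X, traceZeroLine F E c hcδ hδ t) : ↥(adelicUnipotent F E c 3)) : (quasiSplit F E c 3).Adelic) * k) ∂μ := by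
  haveI := isAddHaarMeasure_map_traceZeroLine E c hcδ hδ μ
  have hφd : ∀ u : ↥(adelicUnipotent F E c 3),
      f (((quasiSplit F E c 3).toAdelic (weylLongU (c : E →+* E) (rfl : ((StdForm.antidiagonal 3).over E) = ((StdForm.antidiagonal 3).over E)))) *
          ((u * heisChart hc (L, (0 : traceZeroAdele F E c)) : ↥(adelicUnipotent F E c 3)) : (quasiSplit F E c 3).Adelic) * k) =
        f (((quasiSplit F E c 3).toAdelic (weylLongU (c : E →+* E) (rfl : ((StdForm.antidiagonal 3).over E) = ((StdForm.antidiagonal 3).over E)))) *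
          (u : (quasiSplit F E c 3).Adelic) * k) := fun u => by
    rw [Subgroup.coe_mul]
    have e : ((quasiSplit F E c 3).toAdelic (weylLongU (c : E →+* E) (rfl : ((StdForm.antidiagonal 3).over E) = ((StdForm.antidiagonal 3).over E)))) *
        ((u : (quasiSplit F E c 3).Adelic) * ((heisChart hc (L, (0 : traceZeroAdele F E c)) : ↥(adelicUnipotent F E c 3)) : (quasiSplit F E c 3).Adelic)) * k =
      ((quasiSplit F E c 3).toAdelic (weylLongU (c : E →+* E) (rfl : ((StdForm.antidiagonal 3).over E) = ((StdForm.antidiagonal 3).over E)))) *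
        (u : (quasiSplit F E c 3).Adelic) * k *
        (k⁻¹ * ((heisChart hc (L, (0 : traceZeroAdele F E c)) : ↥(adelicUnipotent F E c 3)) : (quasiSplit F E c 3).Adelic) * k) := by group
    rw [e, hfU _ hk]
  have h := integral_heisChart_add_eq hc (μ.map (traceZeroLine F E c hcδ hδ))
    (φ := fun u : ↥(adelicUnipotent F E c 3) =>
      f (((quasiSplit F E c 3).toAdelic (weylLongU (c : E →+* E) (rfl : ((StdForm.antidiagonal 3).over E) = ((StdForm.antidiagonal 3).over E)))) *
        (u : (quasiSplit F E c 3).Adelic) * k)) hφd X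
  rwa [integral_map_traceZeroLine, integral_map_traceZeroLine] at h

end Periodicity

/-! ## §3 `hlocZ`: the `E`-translates of the centre average -/

section Majorants

variable [MeasurableSpace (AdeleRing (𝓞 F) F)] [BorelSpace (AdeleRing (𝓞 F) F)]

omit [MeasurableSpace (AdeleRing (𝓞 F) F)] [BorelSpace (AdeleRing (𝓞 F) F)] in
/-- ★ FILE A's `hloc` in ★ p857586's spelling of the translate (`x + ξ_𝔸` rather than `ξ_𝔸 + x`). [cite: Garrett2018, §2.8–§2.9] -/
theorem exists_summable_majorant_centre_translate_three' (hc : c * c = 1) (hcδ : c δ = -δ) (hδ : δ ≠ 0) {f : (quasiSplit F E c 3).Adelic → ℂ}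
    (hfB : ∀ b ∈ borelU (c : E →+* E) ((StdForm.antidiagonal 3).over E), ∀ x : (quasiSplit F E c 3).Adelic, f ((quasiSplit F E c 3).toAdelic b * x) = f x)
    (hmaj : ∀ y₀ : (quasiSplit F E c 3).Adelic, ∃ V ∈ 𝓝 y₀,
      ∃ u : Quotient (orbitRel ↥(borelU (c : E →+* E) ((StdForm.antidiagonal 3).over E)) ↥(unitaryGroupOfForm (c : E →+* E) ((StdForm.antidiagonal 3).over E))) → ℝ,
        Summable u ∧ ∀ y ∈ V, ∀ q, ‖f ((quasiSplit F E c 3).toAdelic (q.out : ↥(unitaryGroupOfForm (c : E →+* E) ((StdForm.antidiagonal 3).over E))) * y)‖ ≤ u q)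
    (X : AdeleRing (𝓞 E) E) {C : Set (AdeleRing (𝓞 F) F)} (hC : IsCompact C) (g : (quasiSplit F E c 3).Adelic) :
    ∃ u : F → ℝ, Summable u ∧ ∀ x ∈ C, ∀ ξ : F,
      ‖f (((quasiSplit F E c 3).toAdelic (weylLongU (c : E →+* E) (rfl : ((StdForm.antidiagonal 3).over E) = ((StdForm.antidiagonal 3).over E)))) *
          ((heisChart hc (X, traceZeroLine F E c hcδ hδ (x + algebraMap F (AdeleRing (𝓞 F) F) ξ)) : ↥(adelicUnipotent F E c 3)) : (quasiSplit F E c 3).Adelic) * g)‖ ≤ u ξ := by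
  obtain ⟨u, -, hu, hle⟩ := exists_summable_majorant_centre_translate_three hc hcδ hδ hfB hmaj isCompact_singleton hC g
  exact ⟨u, hu, fun x hx ξ => by rw [add_comm]; exact hle X (mem_singleton X) x hx ξ⟩

/-- **`hlocZ`: THE `E`-TRANSLATES OF THE CENTRE AVERAGE ARE DOMINATED BY A SUMMABLE SEQUENCE**, locally uniformly: for compact `C_X ⊆ 𝔸_E` and every `g` ONE summable `u : E → ℝ`
with `‖Φ^Z_g(X + ξ₀)‖ ≤ u(ξ₀)` for `X ∈ C_X`, `ξ₀ ∈ E` — `u(X + ξ₀, θ t) = u(ξ₀, 0)·u(X, θ t − ω)` (§1; the shift dies in `dt`, Mathlib `integral_add_left_eq_self`), then the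
`F`-lattice decomposition of `∫⁻‖·‖` (§0) and `u(ξ₀, 0)·u(0, θ τ) = u(ξ₀, θ τ)` reduce to FILE A's master majorant at the cosets `[w₀ u(ξ₀, τδ)]`; `Σ_{ξ₀} Σ_τ U(ξ₀,τ) < ∞`
(Mathlib `summable_prod_of_nonneg`).  The `hlocZ` binder of ★ p857586 is the case `C_X = C`. [cite: MoeglinWaldspurger1995, II.1.7] [cite: Garrett2018, §2.8–§2.9]
[cite: CasselsFrohlichANT1967, Ch. XV Lemma 4.2.4] -/
theorem exists_summable_majorant_centreAverage_translate_three (hc : c * c = 1) (hcδ : c δ = -δ) (hδ : δ ≠ 0)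
    (μF : Measure (AdeleRing (𝓞 F) F)) [μF.IsAddHaarMeasure] {f : (quasiSplit F E c 3).Adelic → ℂ}
    (hfB : ∀ b ∈ borelU (c : E →+* E) ((StdForm.antidiagonal 3).over E), ∀ x : (quasiSplit F E c 3).Adelic, f ((quasiSplit F E c 3).toAdelic b * x) = f x)
    (hmaj : ∀ y₀ : (quasiSplit F E c 3).Adelic, ∃ V ∈ 𝓝 y₀,
      ∃ u : Quotient (orbitRel ↥(borelU (c : E →+* E) ((StdForm.antidiagonal 3).over E)) ↥(unitaryGroupOfForm (c : E →+* E) ((StdForm.antidiagonal 3).over E))) → ℝ,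
        Summable u ∧ ∀ y ∈ V, ∀ q, ‖f ((quasiSplit F E c 3).toAdelic (q.out : ↥(unitaryGroupOfForm (c : E →+* E) ((StdForm.antidiagonal 3).over E))) * y)‖ ≤ u q)
    {CX : Set (AdeleRing (𝓞 E) E)} (hCX : IsCompact CX) (g : (quasiSplit F E c 3).Adelic) :
    ∃ u : E → ℝ, (∀ ξ₀, 0 ≤ u ξ₀) ∧ Summable u ∧ ∀ X ∈ CX, ∀ ξ₀ : E,
      ‖((μF (adeleFundamentalDomain F)).toReal⁻¹ : ℂ) * ∫ t, f (((quasiSplit F E c 3).toAdelic (weylLongU (c : E →+* E) (rfl : ((StdForm.antidiagonal 3).over E) = ((StdForm.antidiagonal 3).over E)))) *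
        ((heisChart hc (X + algebraMap E (AdeleRing (𝓞 E) E) ξ₀, traceZeroLine F E c hcδ hδ t) : ↥(adelicUnipotent F E c 3)) : (quasiSplit F E c 3).Adelic) * g) ∂μF‖ ≤ u ξ₀ := by
  classical
  obtain ⟨U, hU0, hU, hle⟩ := exists_summable_majorant_weylLongU_ratHeis_three hc hcδ hδ hfB hmaj hCX (isCompact_closure_adeleFundamentalDomain F) g
  -- abbreviations
  set W : (quasiSplit F E c 3).Adelic :=
    (quasiSplit F E c 3).toAdelic (weylLongU (c : E →+* E) (rfl : ((StdForm.antidiagonal 3).over E) = ((StdForm.antidiagonal 3).over E))) with hW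
  set cst : ℂ := ((μF (adeleFundamentalDomain F)).toReal⁻¹ : ℂ) with hcst
  -- the fibrewise sums `Σ_τ U(ξ₀, τ)` are summable in `ξ₀`
  have hUprod := (summable_prod_of_nonneg (f := U) fun p => hU0 p).1 hU
  refine ⟨fun ξ₀ => ‖cst‖ * ((∑' τ : F, U (ξ₀, τ)) * (μF (adeleFundamentalDomain F)).toReal),
    fun ξ₀ => mul_nonneg (norm_nonneg _) (mul_nonneg (tsum_nonneg fun τ => hU0 _) ENNReal.toReal_nonneg),
    (hUprod.2.mul_right _).mul_left _, fun X hX ξ₀ => ?_⟩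
  set L : AdeleRing (𝓞 E) E := algebraMap E (AdeleRing (𝓞 E) E) ξ₀ with hL
  -- the integrand after moving `u(ξ₀, 0)` to the left: `G(t) = f(W · u(L,0) · (u(X, θ t) · g))`
  set G : AdeleRing (𝓞 F) F → ℂ := fun t =>
    f (W * ((heisChart hc (L, (0 : traceZeroAdele F E c)) : ↥(adelicUnipotent F E c 3)) : (quasiSplit F E c 3).Adelic) *
      (((heisChart hc (X, traceZeroLine F E c hcδ hδ t) : ↥(adelicUnipotent F E c 3)) : (quasiSplit F E c 3).Adelic) * g)) with hG
  set ω : traceZeroAdele F E c := coordY hc (heisChart hc (L, 0) * heisChart hc (X, 0)) with hω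
  -- (1) `Φ_g(X + L, t) = G(t − θ⁻¹ ω)`, so the integrals agree
  have hshift : ∀ t : AdeleRing (𝓞 F) F,
      f (W * ((heisChart hc (X + L, traceZeroLine F E c hcδ hδ t) : ↥(adelicUnipotent F E c 3)) : (quasiSplit F E c 3).Adelic) * g) =
        G (-((traceZeroLine F E c hcδ hδ).symm ω) + t) := by
    intro t
    have e : heisChart hc (X + L, traceZeroLine F E c hcδ hδ t) =
        heisChart hc (L, 0) * heisChart hc (X, traceZeroLine F E c hcδ hδ (-((traceZeroLine F E c hcδ hδ).symm ω) + t)) := by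
      rw [heisChart_fst_zero_mul hc L X, ← hω, map_add, map_neg, ContinuousAddEquiv.apply_symm_apply, add_comm L X, neg_add_cancel_comm]
    simp only [hG, e, Subgroup.coe_mul, mul_assoc]
  have hint : ∫ t, f (W * ((heisChart hc (X + L, traceZeroLine F E c hcδ hδ t) : ↥(adelicUnipotent F E c 3)) : (quasiSplit F E c 3).Adelic) * g) ∂μF = ∫ t, G t ∂μF := by
    simp_rw [hshift]
    exact integral_add_left_eq_self G _
  -- (2) the lattice bound for `G`: `‖G(τ + t)‖ ≤ U(ξ₀, τ)` for `t ∈ D_F`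
  have hGle : ∀ x ∈ adeleFundamentalDomain F, ∀ τ : F, ‖G (algebraMap F (AdeleRing (𝓞 F) F) τ + x)‖ ≤ U (ξ₀, τ) := by
    intro x hx τ
    have e : W * ((heisChart hc (L, (0 : traceZeroAdele F E c)) : ↥(adelicUnipotent F E c 3)) : (quasiSplit F E c 3).Adelic) *
        (((heisChart hc (X, traceZeroLine F E c hcδ hδ (algebraMap F (AdeleRing (𝓞 F) F) τ + x)) : ↥(adelicUnipotent F E c 3)) : (quasiSplit F E c 3).Adelic) * g) =
      W * ((heisChart hc (algebraMap E (AdeleRing (𝓞 E) E) ξ₀, traceZeroLine F E c hcδ hδ (algebraMap F (AdeleRing (𝓞 F) F) τ)) : ↥(adelicUnipotent F E c 3)) :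
          (quasiSplit F E c 3).Adelic) *
        (((heisChart hc (X, traceZeroLine F E c hcδ hδ x) : ↥(adelicUnipotent F E c 3)) : (quasiSplit F E c 3).Adelic) * g) := by
      rw [map_add, add_comm (traceZeroLine F E c hcδ hδ (algebraMap F (AdeleRing (𝓞 F) F) τ)), ← heisChart_zero_mul hc X, Subgroup.coe_mul, ← hL]
      have e2 : heisChart hc (L, traceZeroLine F E c hcδ hδ (algebraMap F (AdeleRing (𝓞 F) F) τ)) =
          heisChart hc (L, (0 : traceZeroAdele F E c)) * heisChart hc (0, traceZeroLine F E c hcδ hδ (algebraMap F (AdeleRing (𝓞 F) F) τ)) := by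
        rw [heisChart_mul_zero hc L, zero_add]
      rw [e2, Subgroup.coe_mul]
      simp only [mul_assoc]
    show ‖f _‖ ≤ _
    rw [e]
    exact hle X hX x (subset_closure hx) (ξ₀, τ)
  have hlint := lintegral_enorm_le_of_lattice_majorant F μF G (fun τ => hU0 (ξ₀, τ)) (hUprod.1 ξ₀) hGle
  have htop : ENNReal.ofReal (∑' τ : F, U (ξ₀, τ)) * μF (adeleFundamentalDomain F) ≠ ⊤ :=
    ENNReal.mul_ne_top ENNReal.ofReal_ne_top
      ((measure_mono subset_closure).trans_lt (isCompact_closure_adeleFundamentalDomain F).measure_lt_top).ne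
  -- (3) assemble
  rw [hint, norm_mul]
  refine mul_le_mul_of_nonneg_left ?_ (norm_nonneg _)
  calc ‖∫ t, G t ∂μF‖ ≤ (∫⁻ t, ENNReal.ofReal ‖G t‖ ∂μF).toReal := norm_integral_le_lintegral_norm G
    _ = (∫⁻ t, ‖G t‖ₑ ∂μF).toReal := by simp_rw [ofReal_norm]
    _ ≤ (ENNReal.ofReal (∑' τ : F, U (ξ₀, τ)) * μF (adeleFundamentalDomain F)).toReal := ENNReal.toReal_mono htop hlint
    _ = (∑' τ : F, U (ξ₀, τ)) * (μF (adeleFundamentalDomain F)).toReal := by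
        rw [ENNReal.toReal_mul, ENNReal.toReal_ofReal (tsum_nonneg fun τ => hU0 _)]

/-! ## §4 `hΦZc`: continuity of the centre average -/

/-- **`hΦZc`: `X ↦ ∫ f(ι(w₀)·u(X, θ t)·g) dμ_F(t)` IS CONTINUOUS ON `𝔸_E`** (`f` continuous, left-`B(F)`-invariant, with the Eisenstein majorant): dominated convergence on a compact
neighbourhood `C_X` of each point (Mathlib `continuousOn_of_dominated`) with the lattice-piecewise-constant bound `t ↦ Σ_τ 𝟙_{τ + D_F}(t) · u(τ)` from FILE A's `hloc` on `C_X × D_F⁻`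
(integrable by ★ `integrable_tsum_of_tsum_lintegral_enorm_ne_top`: `Σ_τ u(τ)·μ(D_F) < ∞`). [cite: MoeglinWaldspurger1995, II.1.7] [cite: Rudin1987, Thm. 1.38] -/
theorem continuous_integral_weylLongU_mul_heisChart_three (hc : c * c = 1) (hcδ : c δ = -δ) (hδ : δ ≠ 0)
    (μF : Measure (AdeleRing (𝓞 F) F)) [μF.IsAddHaarMeasure] {f : (quasiSplit F E c 3).Adelic → ℂ} (hf : Continuous f)
    (hfB : ∀ b ∈ borelU (c : E →+* E) ((StdForm.antidiagonal 3).over E), ∀ x : (quasiSplit F E c 3).Adelic, f ((quasiSplit F E c 3).toAdelic b * x) = f x)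
    (hmaj : ∀ y₀ : (quasiSplit F E c 3).Adelic, ∃ V ∈ 𝓝 y₀,
      ∃ u : Quotient (orbitRel ↥(borelU (c : E →+* E) ((StdForm.antidiagonal 3).over E)) ↥(unitaryGroupOfForm (c : E →+* E) ((StdForm.antidiagonal 3).over E))) → ℝ,
        Summable u ∧ ∀ y ∈ V, ∀ q, ‖f ((quasiSplit F E c 3).toAdelic (q.out : ↥(unitaryGroupOfForm (c : E →+* E) ((StdForm.antidiagonal 3).over E))) * y)‖ ≤ u q)
    (g : (quasiSplit F E c 3).Adelic) :
    Continuous fun X : AdeleRing (𝓞 E) E => ∫ t, f (((quasiSplit F E c 3).toAdelic (weylLongU (c : E →+* E) (rfl : ((StdForm.antidiagonal 3).over E) = ((StdForm.antidiagonal 3).over E)))) *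
      ((heisChart hc (X, traceZeroLine F E c hcδ hδ t) : ↥(adelicUnipotent F E c 3)) : (quasiSplit F E c 3).Adelic) * g) ∂μF := by
  classical
  haveI := locallyCompactSpace_adeleRing' E
  haveI := secondCountableTopology_adeleRing E
  haveI : Countable F := NumberField.countable' (K := F)
  have hjoint := continuous_weylLongU_mul_heisChart_mul hc hcδ hδ hf g
  refine continuous_iff_continuousAt.2 fun X₀ => ?_
  obtain ⟨CX, hCX, hCXn⟩ := exists_compact_mem_nhds X₀
  refine ContinuousOn.continuousAt ?_ hCXn
  -- the bound on `C_X`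
  obtain ⟨u, hu0, hu, hle⟩ := exists_summable_majorant_centre_translate_three hc hcδ hδ hfB hmaj hCX (isCompact_closure_adeleFundamentalDomain F) g
  set S : F → Set (AdeleRing (𝓞 F) F) := fun τ => (fun t => -algebraMap F (AdeleRing (𝓞 F) F) τ + t) ⁻¹' adeleFundamentalDomain F with hS
  have hSm : ∀ τ, MeasurableSet (S τ) := fun τ => (measurableSet_adeleFundamentalDomain F).preimage (measurable_const_add _)
  have hSμ : ∀ τ, μF (S τ) = μF (adeleFundamentalDomain F) := fun τ => measure_preimage_add μF _ _
  set bound : AdeleRing (𝓞 F) F → ℝ := fun t => ∑' τ : F, (S τ).indicator (fun _ => u τ) t with hbound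
  -- integrability of the bound (Rudin 1.38)
  have hbi : Integrable bound μF := by
    refine (integrable_tsum_of_tsum_lintegral_enorm_ne_top (μ := μF) (g := fun (τ : F) (t : AdeleRing (𝓞 F) F) => (S τ).indicator (fun _ => u τ) t)
      (fun τ => (aestronglyMeasurable_const.indicator (hSm τ))) ?_).1
    have hterm : ∀ τ : F, ∫⁻ t, ‖(S τ).indicator (fun _ => u τ) t‖ₑ ∂μF = ENNReal.ofReal (u τ) * μF (adeleFundamentalDomain F) := fun τ => by
      have h1 : (fun t => ‖(S τ).indicator (fun _ => u τ) t‖ₑ) = (S τ).indicator fun _ => ENNReal.ofReal (u τ) := by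
        funext t
        rw [enorm_indicator_eq_indicator_enorm]
        simp only [Set.indicator_apply, Real.enorm_eq_ofReal (hu0 τ)]
      rw [h1, lintegral_indicator_const (hSm τ), hSμ]
    simp_rw [hterm]
    rw [ENNReal.tsum_mul_right, ← ENNReal.ofReal_tsum_of_nonneg hu0 hu]
    exact ENNReal.mul_ne_top ENNReal.ofReal_ne_top
      ((measure_mono subset_closure).trans_lt (isCompact_closure_adeleFundamentalDomain F).measure_lt_top).ne
  refine continuousOn_of_dominated (bound := bound) (fun X _ => ((hjoint.comp (continuous_const.prodMk continuous_id)).aestronglyMeasurable))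
    (fun X hX => Eventually.of_forall fun t => ?_) hbi (Eventually.of_forall fun t => (hjoint.comp (continuous_id.prodMk continuous_const)).continuousOn)
  -- the pointwise bound: `t = (−τ₀)_𝔸 + x` with `x ∈ D_F`
  obtain ⟨γ, hγ, -⟩ := existsUnique_vadd_mem_adeleFundamentalDomain F t
  set τ₀ : F := (principalSubgroupEquiv F).symm γ with hτ₀
  have hγτ : (γ : AdeleRing (𝓞 F) F) = algebraMap F (AdeleRing (𝓞 F) F) τ₀ := by
    rw [hτ₀, ← show ((principalSubgroupEquiv F ((principalSubgroupEquiv F).symm γ) : AdeleRing.principalSubgroup (𝓞 F) F) : AdeleRing (𝓞 F) F) =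
      algebraMap F (AdeleRing (𝓞 F) F) ((principalSubgroupEquiv F).symm γ) from rfl, Equiv.apply_symm_apply]
  have hx : (γ : AdeleRing (𝓞 F) F) + t ∈ adeleFundamentalDomain F := hγ
  have ht : t = algebraMap F (AdeleRing (𝓞 F) F) (-τ₀) + ((γ : AdeleRing (𝓞 F) F) + t) := by rw [map_neg, ← hγτ, neg_add_cancel_left]
  have h1 : ‖f (((quasiSplit F E c 3).toAdelic (weylLongU (c : E →+* E) (rfl : ((StdForm.antidiagonal 3).over E) = ((StdForm.antidiagonal 3).over E)))) *
      ((heisChart hc (X, traceZeroLine F E c hcδ hδ t) : ↥(adelicUnipotent F E c 3)) : (quasiSplit F E c 3).Adelic) * g)‖ ≤ u (-τ₀) := by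
    rw [ht]
    exact hle X hX _ (subset_closure hx) (-τ₀)
  have hmemS : t ∈ S (-τ₀) := by
    show -algebraMap F (AdeleRing (𝓞 F) F) (-τ₀) + t ∈ adeleFundamentalDomain F
    rwa [map_neg, neg_neg, ← hγτ]
  have hsum : Summable fun τ : F => (S τ).indicator (fun _ => u τ) t :=
    Summable.of_nonneg_of_le (fun τ => Set.indicator_nonneg (fun _ _ => hu0 τ) _) (fun τ => Set.indicator_le_self' (fun _ _ => hu0 τ) t) hu
  have h2 : u (-τ₀) ≤ bound t := by
    have h := hsum.le_tsum (-τ₀) fun τ _ => Set.indicator_nonneg (fun _ _ => hu0 τ) _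
    rwa [Set.indicator_of_mem hmemS] at h
  exact h1.trans h2

/-- **`hΦZc` in ★ p857586's letters**: `X ↦ Φ^Z_g(X) = ((μ_F D_F).toReal⁻¹ : ℂ) · ∫ Φ_g(X, t) dμ_F(t)` is continuous. [cite: MoeglinWaldspurger1995, II.1.7] -/
theorem continuous_centreAverage_three (hc : c * c = 1) (hcδ : c δ = -δ) (hδ : δ ≠ 0)
    (μF : Measure (AdeleRing (𝓞 F) F)) [μF.IsAddHaarMeasure] {f : (quasiSplit F E c 3).Adelic → ℂ} (hf : Continuous f)
    (hfB : ∀ b ∈ borelU (c : E →+* E) ((StdForm.antidiagonal 3).over E), ∀ x : (quasiSplit F E c 3).Adelic, f ((quasiSplit F E c 3).toAdelic b * x) = f x)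
    (hmaj : ∀ y₀ : (quasiSplit F E c 3).Adelic, ∃ V ∈ 𝓝 y₀,
      ∃ u : Quotient (orbitRel ↥(borelU (c : E →+* E) ((StdForm.antidiagonal 3).over E)) ↥(unitaryGroupOfForm (c : E →+* E) ((StdForm.antidiagonal 3).over E))) → ℝ,
        Summable u ∧ ∀ y ∈ V, ∀ q, ‖f ((quasiSplit F E c 3).toAdelic (q.out : ↥(unitaryGroupOfForm (c : E →+* E) ((StdForm.antidiagonal 3).over E))) * y)‖ ≤ u q)
    (g : (quasiSplit F E c 3).Adelic) :
    Continuous fun X : AdeleRing (𝓞 E) E => ((μF (adeleFundamentalDomain F)).toReal⁻¹ : ℂ) *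
      ∫ t, f (((quasiSplit F E c 3).toAdelic (weylLongU (c : E →+* E) (rfl : ((StdForm.antidiagonal 3).over E) = ((StdForm.antidiagonal 3).over E)))) *
        ((heisChart hc (X, traceZeroLine F E c hcδ hδ t) : ↥(adelicUnipotent F E c 3)) : (quasiSplit F E c 3).Adelic) * g) ∂μF :=
  continuous_const.mul (continuous_integral_weylLongU_mul_heisChart_three hc hcδ hδ μF hf hfB hmaj g)

/-! ## §5 `hΦZi`: integrability of the centre average on `𝔸_E` -/

/-- **`hΦZi`: `Φ^Z_g ∈ L¹(𝔸_E)`** for every additive Haar `μ_E` (★ FILE A §0 over `E` with §3's majorant on `D_E⁻` and §4's continuity). [cite: MoeglinWaldspurger1995, II.1.7]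
[cite: CasselsFrohlichANT1967, Ch. XV Lemma 4.2.4] -/
theorem integrable_centreAverage_three (hc : c * c = 1) (hcδ : c δ = -δ) (hδ : δ ≠ 0)
    (μF : Measure (AdeleRing (𝓞 F) F)) [μF.IsAddHaarMeasure]
    [MeasurableSpace (AdeleRing (𝓞 E) E)] [BorelSpace (AdeleRing (𝓞 E) E)] (μE : Measure (AdeleRing (𝓞 E) E)) [μE.IsAddHaarMeasure]
    {f : (quasiSplit F E c 3).Adelic → ℂ} (hf : Continuous f)
    (hfB : ∀ b ∈ borelU (c : E →+* E) ((StdForm.antidiagonal 3).over E), ∀ x : (quasiSplit F E c 3).Adelic, f ((quasiSplit F E c 3).toAdelic b * x) = f x)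
    (hmaj : ∀ y₀ : (quasiSplit F E c 3).Adelic, ∃ V ∈ 𝓝 y₀,
      ∃ u : Quotient (orbitRel ↥(borelU (c : E →+* E) ((StdForm.antidiagonal 3).over E)) ↥(unitaryGroupOfForm (c : E →+* E) ((StdForm.antidiagonal 3).over E))) → ℝ,
        Summable u ∧ ∀ y ∈ V, ∀ q, ‖f ((quasiSplit F E c 3).toAdelic (q.out : ↥(unitaryGroupOfForm (c : E →+* E) ((StdForm.antidiagonal 3).over E))) * y)‖ ≤ u q)
    (g : (quasiSplit F E c 3).Adelic) :
    Integrable (fun X : AdeleRing (𝓞 E) E => ((μF (adeleFundamentalDomain F)).toReal⁻¹ : ℂ) *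
      ∫ t, f (((quasiSplit F E c 3).toAdelic (weylLongU (c : E →+* E) (rfl : ((StdForm.antidiagonal 3).over E) = ((StdForm.antidiagonal 3).over E)))) *
        ((heisChart hc (X, traceZeroLine F E c hcδ hδ t) : ↥(adelicUnipotent F E c 3)) : (quasiSplit F E c 3).Adelic) * g) ∂μF) μE := by
  obtain ⟨u, hu0, hu, hle⟩ := exists_summable_majorant_centreAverage_translate_three hc hcδ hδ μF hfB hmaj (isCompact_closure_adeleFundamentalDomain E) g
  refine integrable_of_lattice_majorant E μE (continuous_centreAverage_three hc hcδ hδ μF hf hfB hmaj g).aestronglyMeasurable hu0 hu fun x hx ξ₀ => ?_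
  rw [add_comm]
  exact hle x (subset_closure hx) ξ₀

end Majorants

end Heisenberg

end Summit.HodgeConjecture.HodgeConjecture.Cruxes.H413.K2E1FlatSectionCentreAverageU3

end
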